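import Summits.Ventures.YMGap.Thresholds.OneLinkLevelTwoBootRows
import Summits.Ventures.YMGap.Thresholds.OneLinkLevelTwoQuadTilde
import HarnessLib

/-!
# Venture YMGap — the one-link modulus beyond first order, part 52: the LINEAR-BOOTSTRAP level-two modulus with the SHARPER
# SECOND MOMENT `ω̃` — `K₂BT(N, R)`, every `SU(N)`, `N ≥ 3`, hypothesis-free, stated with ABSTRACT INGREDIENT MAJORANTS

HONEST FRAMING: venture file of the cell `pub-ymgap` (QuantumFields programme), strong-coupling LATTICE bookkeeping for `SU(N)`
lattice Yang–Mills; nothing about the continuum or the mass gap in the Clay sense.  Re-instantiation of `OneLinkLevelTwoBoot`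
(`levelTwo_algebraWAQB`, split engine `cov_linear_le_of_poisson_split`) with TWO inputs replaced: (i) the second-moment scale
`W = N ω̂(N,r)` of the linear statistics `tr(gB)`, `tr(gΔ)` (hypotheses `F1`, `F2`) becomes `W = N ω̃(N,r)` from `OneLinkSDVarianceQuad`
(`ω̃(N,r) = (τ + r²)/4 + √((τ + r²)²/16 + r²/N²)`, `→ (r²+τ)/2` as `N → ∞`, against `ω̂ → r²`); (ii) the nested modulus bound on the
linear part of the cubic remainder is `cov_linear_le_levelTwoQT_explicit` (`K₂QT`) instead of `K₂Q`.  The resulting constant is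
  `K₂BT(N,R) = C·( √((1+ω⁺)/2) + E R + 2(E+¼)ω̃ + [ (3E/2)R² + (2E+¼)τ + (10E+½)R ω̃ ] / (½ − R) + (3E/2)R²·K₂QT(N,R) )`,
`C = N²/(N²−1)`, `E = N²/(2(N²−4))` (`ω⁺`, inside the A-part, keeps its `ω̂`).  NEW IN FORM: the theorems are stated for ARBITRARY
MAJORANTS `A ≥ √((1+ω⁺)/2)`, `w ≥ ω̃`, `τ' ≥ τ`, `K ≥ K₂QT`, `C' ≥ C`, `E' ≥ E`, `R' ≥ r` of the seven ingredients (the closed form is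
the instance with equalities; its ≈ 5 kB statement is kept out of this file because its elaboration alone costs ≈ 10⁶ heartbeats —
the numerical rows instantiate the majorants with rationals directly, which is all the doors need).
Numbers (float screen of this seat, cell folder `work/hier/k2_bt.py`): `K₂BT(10, .258) = 1.92` against `K₂B = 2.06`; star-door rows
(next files, exact rationals) `19/500 | 1/24 | 11/250 | 91/2000 | 11/240` for `N ≥ 4 | 6 | 10 | 20 | 50` (`K₂B` column of record
`3/80 | 41/1000 | 43/1000 | 11/250 | —`).  Cell note `HOME/p2/ONE-LINK-HIERARCHY.md` §15 (2′).  Sentence-grade.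
* `levelTwoQT_nonneg`;
* `cov_linear_le_levelTwoBT_of_le`: `|Cov_ν_B(φ, N Re tr(·Δ))| ≤ C'(A + E'R' + 2(E'+¼)w + ((3/2)E'R'² + (2E'+¼)τ' + (10E'+½)R'w)/(½−R')
  + (3/2)E'R'²K)·L·‖Δ‖_F` for every majorant system at `‖B‖_op ≤ R' < 1/2`;
* `oneLinkKRModulus_levelTwoBT_of_le (hN : 3 ≤ N) (hRR' : R ≤ R') (hR' : R' < 1/2) (majorants at radius R) :
  OneLinkKRModulus N R (C'(A + E'R' + …))`.
-/

noncomputable section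

open scoped Matrix ComplexConjugate BigOperators ContDiff Matrix.Norms.Frobenius
open Matrix Complex Finset MeasureTheory ProbabilityTheory
open Literature.MathematicalPhysics.QuantumFieldTheory
open Literature.MathematicalPhysics.QuantumFieldTheory.SUNBakryEmery
open Literature.MathematicalPhysics.QuantumFieldTheory.Balaban1983to89.StrongCouplingDobrushinWindow
open Literature.MathematicalPhysics.QuantumFieldTheory.Balaban1983to89.StrongCouplingKernelWindow

namespace Summit.Ventures.YMGap.OneLinkEigen

variable {N : ℕ}

/-! ### Non-negativity of the nested constant -/

/-- `0 ≤ K₂QT(N, r)` for `0 ≤ r < 1/2` (`N ≥ 3`). [folklore] -/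
theorem levelTwoQT_nonneg (hN : 3 ≤ N) {r : ℝ} (hr : 0 ≤ r) (hr2 : r < 1 / 2) : 0 ≤ ((N : ℝ) ^ 2 / ((N : ℝ) ^ 2 - 1)) *
        (Real.sqrt ((1 +
            (2 * ((N : ℝ) * (2 * (N : ℝ) - 4 / N) / ((2 * (N : ℝ) - 4 / N) ^ 2 - 4)) *
            (r + (r ^ 2 / 2 + r * Real.sqrt (r ^ 2 / 4 + 1 / (N : ℝ) ^ 2)))
          + 2 * (2 * (N : ℝ) / ((2 * (N : ℝ) - 4 / N) ^ 2 - 4)) * N *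
            ((r ^ 2 / 2 + r * Real.sqrt (r ^ 2 / 4 + 1 / (N : ℝ) ^ 2))
              + r * (r / 2 + Real.sqrt (r ^ 2 / 4 + 1 / (N : ℝ) ^ 2)) ^ 2))) / 2)
          + ((N : ℝ) ^ 2 / (2 * ((N : ℝ) ^ 2 - 4))) * r + 2 * (((N : ℝ) ^ 2 / (2 * ((N : ℝ) ^ 2 - 4))) + 1 / 4) * (((r * ((r ^ 2 * (1 + r / 2 + Real.sqrt (r ^ 2 / 4 + 1 / (N : ℝ) ^ 2)) / (2 - 4 / (N : ℝ) ^ 2)) / 2 + Real.sqrt ((r ^ 2 * (1 + r / 2 + Real.sqrt (r ^ 2 / 4 + 1 / (N : ℝ) ^ 2)) / (2 - 4 / (N : ℝ) ^ 2)) ^ 2 / 4 + (r ^ 2 * (4 / (N : ℝ) ^ 2 + 2 * (r / 2 + Real.sqrt (r ^ 2 / 4 + 1 / (N : ℝ) ^ 2)) ^ 2) / (2 - 4 / (N : ℝ) ^ 2))))) + r ^ 2) / 4 + Real.sqrt (((r * ((r ^ 2 * (1 + r / 2 + Real.sqrt (r ^ 2 / 4 + 1 / (N : ℝ) ^ 2))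 / (2 - 4 / (N : ℝ) ^ 2)) / 2 + Real.sqrt ((r ^ 2 * (1 + r / 2 + Real.sqrt (r ^ 2 / 4 + 1 / (N : ℝ) ^ 2)) / (2 - 4 / (N : ℝ) ^ 2)) ^ 2 / 4 + (r ^ 2 * (4 / (N : ℝ) ^ 2 + 2 * (r / 2 + Real.sqrt (r ^ 2 / 4 + 1 / (N : ℝ) ^ 2)) ^ 2) / (2 - 4 / (N : ℝ) ^ 2))))) + r ^ 2) ^ 2 / 16 + r ^ 2 / (N : ℝ) ^ 2))
          + (3 * ((N : ℝ) ^ 2 / (2 * ((N : ℝ) ^ 2 - 4))) * r ^ 2 + (2 * ((N : ℝ) ^ 2 / (2 * ((N : ℝ) ^ 2 - 4))) + 1 / 4) * (r * ((r ^ 2 * (1 + r / 2 + Real.sqrt (r ^ 2 / 4 + 1 / (N : ℝ) ^ 2)) / (2 - 4 / (N : ℝ) ^ 2)) / 2 + Real.sqrt ((r ^ 2 * (1 + r / 2 + Real.sqrt (r ^ 2 / 4 + 1 / (N : ℝ) ^ 2)) / (2 - 4 / (N : ℝ) ^ 2)) ^ 2 / 4 + (r ^ 2 * (4 / (N : ℝ)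 ^ 2 + 2 * (r / 2 + Real.sqrt (r ^ 2 / 4 + 1 / (N : ℝ) ^ 2)) ^ 2) / (2 - 4 / (N : ℝ) ^ 2)))))
              + (10 * ((N : ℝ) ^ 2 / (2 * ((N : ℝ) ^ 2 - 4))) + 1 / 2) * r * (((r * ((r ^ 2 * (1 + r / 2 + Real.sqrt (r ^ 2 / 4 + 1 / (N : ℝ) ^ 2)) / (2 - 4 / (N : ℝ) ^ 2)) / 2 + Real.sqrt ((r ^ 2 * (1 + r / 2 + Real.sqrt (r ^ 2 / 4 + 1 / (N : ℝ) ^ 2)) / (2 - 4 / (N : ℝ) ^ 2)) ^ 2 / 4 + (r ^ 2 * (4 / (N : ℝ) ^ 2 + 2 * (r / 2 + Real.sqrt (r ^ 2 / 4 + 1 / (N : ℝ) ^ 2)) ^ 2) / (2 - 4 / (N : ℝ) ^ 2))))) + r ^ 2) / 4 + Real.sqrt (((r * ((r ^ 2 * (1 + r / 2 + Real.sqrt (r ^ 2 / 4 + 1 / (N : ℝ) ^ 2)) / (2 - 4 / (N : ℝ) ^ 2)) / 2 + Real.sqrt ((r ^ 2 * (1 + r / 2 + Real.sqrt (r ^ 2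 / 4 + 1 / (N : ℝ) ^ 2)) / (2 - 4 / (N : ℝ) ^ 2)) ^ 2 / 4 + (r ^ 2 * (4 / (N : ℝ) ^ 2 + 2 * (r / 2 + Real.sqrt (r ^ 2 / 4 + 1 / (N : ℝ) ^ 2)) ^ 2) / (2 - 4 / (N : ℝ) ^ 2))))) + r ^ 2) ^ 2 / 16 + r ^ 2 / (N : ℝ) ^ 2))) / (1 / 2 - r)) := by
  have h3 : (3 : ℝ) ≤ N := by exact_mod_cast hN
  have : 0 ≤ (N : ℝ) ^ 2 / ((N : ℝ) ^ 2 - 1) := div_nonneg (by positivity) (by nlinarith only [h3])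
  have : 0 ≤ (N : ℝ) ^ 2 / (2 * ((N : ℝ) ^ 2 - 4)) := div_nonneg (by positivity) (by nlinarith only [h3])
  have : 0 < 1 / 2 - r := by linarith only [hr2]
  have : 0 ≤ (r * ((r ^ 2 * (1 + r / 2 + Real.sqrt (r ^ 2 / 4 + 1 / (N : ℝ) ^ 2)) / (2 - 4 / (N : ℝ) ^ 2)) / 2 + Real.sqrt ((r ^ 2 * (1 + r / 2 + Real.sqrt (r ^ 2 / 4 + 1 / (N : ℝ) ^ 2)) / (2 - 4 / (N : ℝ) ^ 2)) ^ 2 / 4 + (r ^ 2 * (4 / (N : ℝ) ^ 2 + 2 * (r / 2 + Real.sqrt (r ^ 2 / 4 + 1 / (N : ℝ) ^ 2)) ^ 2) / (2 - 4 / (N : ℝ) ^ 2))))) := tau_nonneg hN hr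
  have : 0 ≤ (((r * ((r ^ 2 * (1 + r / 2 + Real.sqrt (r ^ 2 / 4 + 1 / (N : ℝ) ^ 2)) / (2 - 4 / (N : ℝ) ^ 2)) / 2 + Real.sqrt ((r ^ 2 * (1 + r / 2 + Real.sqrt (r ^ 2 / 4 + 1 / (N : ℝ) ^ 2)) / (2 - 4 / (N : ℝ) ^ 2)) ^ 2 / 4 + (r ^ 2 * (4 / (N : ℝ) ^ 2 + 2 * (r / 2 + Real.sqrt (r ^ 2 / 4 + 1 / (N : ℝ) ^ 2)) ^ 2) / (2 - 4 / (N : ℝ) ^ 2))))) + r ^ 2) / 4 + Real.sqrt (((r * ((r ^ 2 * (1 + r / 2 + Real.sqrt (r ^ 2 / 4 + 1 / (N : ℝ) ^ 2)) / (2 - 4 / (N : ℝ) ^ 2)) / 2 + Real.sqrt ((r ^ 2 * (1 + r / 2 + Real.sqrt (r ^ 2 / 4 + 1 / (N : ℝ) ^ 2)) / (2 - 4 / (N : ℝ) ^ 2)) ^ 2 / 4 + (r ^ 2 * (4 / (N : ℝ) ^ 2 + 2 * (r / 2 + Real.sqrt (r ^ 2 / 4 + 1 / (N : ℝ) ^ 2))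 ^ 2) / (2 - 4 / (N : ℝ) ^ 2))))) + r ^ 2) ^ 2 / 16 + r ^ 2 / (N : ℝ) ^ 2)) := omegaTilde_nonneg hN hr
  positivity

/-! ### The explicit bootstrap bound with abstract majorants -/

set_option maxHeartbeats 400000 in
/-- **THE `ω̃` LINEAR-BOOTSTRAP COVARIANCE BOUND with abstract ingredient majorants.**  `N ≥ 3`, `‖B‖_op ≤ R' < 1/2`, `C(N) ≤ C'`,
`E(N) ≤ E'`, `√((1+ω⁺(N,‖B‖_op))/2) ≤ A`, `ω̃(N,‖B‖_op) ≤ w`, `τ(N,‖B‖_op) ≤ τ`, `K₂QT(N,‖B‖_op) ≤ K`, `φ` bounded measurable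
`L`-Lipschitz (Frobenius) on `SU(N)`:
`|∫ φ · N Re tr(gΔ) dν_B − ∫ φ dν_B ∫ N Re tr(gΔ) dν_B| ≤ C'(A + E'R' + 2(E'+¼)w + ((3/2)E'R'² + (2E'+¼)τ + (10E'+½)R'w)/(½−R') + (3/2)E'R'²K)·L·‖Δ‖_F`.
(The equality instance is `K₂BT(N, ‖B‖_op)`; the double heartbeats are for the elaboration of the ≈ 4 kB of ingredient binders.) [folklore] -/
theorem cov_linear_le_levelTwoBT_of_le (hN : 3 ≤ N) {B : Matrix (Fin N) (Fin N) ℂ} {R' C' E' A w τ K : ℝ}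
    (hr : matrixOpNorm B ≤ R') (hR' : R' < 1 / 2)
    (hC : (N : ℝ) ^ 2 / ((N : ℝ) ^ 2 - 1) ≤ C') (hE : (N : ℝ) ^ 2 / (2 * ((N : ℝ) ^ 2 - 4)) ≤ E')
    (hA : Real.sqrt ((1 +
            (2 * ((N : ℝ) * (2 * (N : ℝ) - 4 / N) / ((2 * (N : ℝ) - 4 / N) ^ 2 - 4)) *
            (matrixOpNorm B + (matrixOpNorm B ^ 2 / 2 + matrixOpNorm B * Real.sqrt (matrixOpNorm B ^ 2 / 4 + 1 / (N : ℝ) ^ 2)))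
          + 2 * (2 * (N : ℝ) / ((2 * (N : ℝ) - 4 / N) ^ 2 - 4)) * N *
            ((matrixOpNorm B ^ 2 / 2 + matrixOpNorm B * Real.sqrt (matrixOpNorm B ^ 2 / 4 + 1 / (N : ℝ) ^ 2))
              + matrixOpNorm B * (matrixOpNorm B / 2 + Real.sqrt (matrixOpNorm B ^ 2 / 4 + 1 / (N : ℝ) ^ 2)) ^ 2))) / 2) ≤ A)
    (hw : (((matrixOpNorm B * ((matrixOpNorm B ^ 2 * (1 + matrixOpNorm B / 2 + Real.sqrt (matrixOpNorm B ^ 2 / 4 + 1 / (N : ℝ) ^ 2)) / (2 - 4 / (N : ℝ) ^ 2)) / 2 + Real.sqrt ((matrixOpNorm B ^ 2 * (1 + matrixOpNorm B / 2 + Real.sqrt (matrixOpNorm B ^ 2 / 4 + 1 / (N : ℝ) ^ 2)) / (2 - 4 / (N : ℝ) ^ 2)) ^ 2 / 4 + (matrixOpNorm B ^ 2 * (4 / (N : ℝ) ^ 2 + 2 * (matrixOpNorm B / 2 + Real.sqrt (matrixOpNorm B ^ 2 / 4 + 1 / (N : ℝ) ^ 2)) ^ 2) / (2 - 4 / (N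 : ℝ) ^ 2))))) + matrixOpNorm B ^ 2) / 4 + Real.sqrt (((matrixOpNorm B * ((matrixOpNorm B ^ 2 * (1 + matrixOpNorm B / 2 + Real.sqrt (matrixOpNorm B ^ 2 / 4 + 1 / (N : ℝ) ^ 2)) / (2 - 4 / (N : ℝ) ^ 2)) / 2 + Real.sqrt ((matrixOpNorm B ^ 2 * (1 + matrixOpNorm B / 2 + Real.sqrt (matrixOpNorm B ^ 2 / 4 + 1 / (N : ℝ) ^ 2)) / (2 - 4 / (N : ℝ) ^ 2)) ^ 2 / 4 + (matrixOpNorm B ^ 2 * (4 / (N : ℝ) ^ 2 + 2 * (matrixOpNorm B / 2 + Real.sqrt (matrixOpNorm B ^ 2 / 4 + 1 / (N : ℝ) ^ 2)) ^ 2) / (2 - 4 / (N : ℝ) ^ 2))))) + matrixOpNorm B ^ 2) ^ 2 / 16 + matrixOpNorm B ^ 2 / (N : ℝ) ^ 2)) ≤ w)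
    (hτ : (matrixOpNorm B * ((matrixOpNorm B ^ 2 * (1 + matrixOpNorm B / 2 + Real.sqrt (matrixOpNorm B ^ 2 / 4 + 1 / (N : ℝ) ^ 2)) / (2 - 4 / (N : ℝ) ^ 2)) / 2 + Real.sqrt ((matrixOpNorm B ^ 2 * (1 + matrixOpNorm B / 2 + Real.sqrt (matrixOpNorm B ^ 2 / 4 + 1 / (N : ℝ) ^ 2)) / (2 - 4 / (N : ℝ) ^ 2)) ^ 2 / 4 + (matrixOpNorm B ^ 2 * (4 / (N : ℝ) ^ 2 + 2 * (matrixOpNorm B / 2 + Real.sqrt (matrixOpNorm B ^ 2 / 4 + 1 / (N : ℝ) ^ 2)) ^ 2) / (2 - 4 / (N : ℝ) ^ 2))))) ≤ τ)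
    (hK : ((N : ℝ) ^ 2 / ((N : ℝ) ^ 2 - 1)) *
        (Real.sqrt ((1 +
            (2 * ((N : ℝ) * (2 * (N : ℝ) - 4 / N) / ((2 * (N : ℝ) - 4 / N) ^ 2 - 4)) *
            (matrixOpNorm B + (matrixOpNorm B ^ 2 / 2 + matrixOpNorm B * Real.sqrt (matrixOpNorm B ^ 2 / 4 + 1 / (N : ℝ) ^ 2)))
          + 2 * (2 * (N : ℝ) / ((2 * (N : ℝ) - 4 / N) ^ 2 - 4)) * N *
            ((matrixOpNorm B ^ 2 / 2 + matrixOpNorm B * Real.sqrt (matrixOpNorm B ^ 2 / 4 + 1 / (N : ℝ) ^ 2))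
              + matrixOpNorm B * (matrixOpNorm B / 2 + Real.sqrt (matrixOpNorm B ^ 2 / 4 + 1 / (N : ℝ) ^ 2)) ^ 2))) / 2)
          + ((N : ℝ) ^ 2 / (2 * ((N : ℝ) ^ 2 - 4))) * matrixOpNorm B + 2 * (((N : ℝ) ^ 2 / (2 * ((N : ℝ) ^ 2 - 4))) + 1 / 4) * (((matrixOpNorm B * ((matrixOpNorm B ^ 2 * (1 + matrixOpNorm B / 2 + Real.sqrt (matrixOpNorm B ^ 2 / 4 + 1 / (N : ℝ) ^ 2)) / (2 - 4 / (N : ℝ) ^ 2)) / 2 + Real.sqrt ((matrixOpNorm B ^ 2 * (1 + matrixOpNorm B / 2 + Real.sqrt (matrixOpNorm B ^ 2 / 4 + 1 / (N : ℝ) ^ 2)) / (2 - 4 / (N : ℝ) ^ 2)) ^ 2 / 4 + (matrixOpNorm B ^ 2 * (4 / (N : ℝ) ^ 2 + 2 * (matrixOpNorm B / 2 + Real.sqrt (matrixOpNorm B ^ 2 / 4 + 1 / (N : ℝ) ^ 2)) ^ 2) / (2 - 4 / (N : ℝ) ^ 2))))) + matrixOpNorm B ^ 2) / 4 + Real.sqrt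 (((matrixOpNorm B * ((matrixOpNorm B ^ 2 * (1 + matrixOpNorm B / 2 + Real.sqrt (matrixOpNorm B ^ 2 / 4 + 1 / (N : ℝ) ^ 2)) / (2 - 4 / (N : ℝ) ^ 2)) / 2 + Real.sqrt ((matrixOpNorm B ^ 2 * (1 + matrixOpNorm B / 2 + Real.sqrt (matrixOpNorm B ^ 2 / 4 + 1 / (N : ℝ) ^ 2)) / (2 - 4 / (N : ℝ) ^ 2)) ^ 2 / 4 + (matrixOpNorm B ^ 2 * (4 / (N : ℝ) ^ 2 + 2 * (matrixOpNorm B / 2 + Real.sqrt (matrixOpNorm B ^ 2 / 4 + 1 / (N : ℝ) ^ 2)) ^ 2) / (2 - 4 / (N : ℝ) ^ 2))))) + matrixOpNorm B ^ 2) ^ 2 / 16 + matrixOpNorm B ^ 2 / (N : ℝ) ^ 2))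
          + (3 * ((N : ℝ) ^ 2 / (2 * ((N : ℝ) ^ 2 - 4))) * matrixOpNorm B ^ 2 + (2 * ((N : ℝ) ^ 2 / (2 * ((N : ℝ) ^ 2 - 4))) + 1 / 4) * (matrixOpNorm B * ((matrixOpNorm B ^ 2 * (1 + matrixOpNorm B / 2 + Real.sqrt (matrixOpNorm B ^ 2 / 4 + 1 / (N : ℝ) ^ 2)) / (2 - 4 / (N : ℝ) ^ 2)) / 2 + Real.sqrt ((matrixOpNorm B ^ 2 * (1 + matrixOpNorm B / 2 + Real.sqrt (matrixOpNorm B ^ 2 / 4 + 1 / (N : ℝ) ^ 2)) / (2 - 4 / (N : ℝ) ^ 2)) ^ 2 / 4 + (matrixOpNorm B ^ 2 * (4 / (N : ℝ) ^ 2 + 2 * (matrixOpNorm B / 2 + Real.sqrt (matrixOpNorm B ^ 2 / 4 + 1 / (N : ℝ) ^ 2)) ^ 2) / (2 - 4 / (N : ℝ) ^ 2)))))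
              + (10 * ((N : ℝ) ^ 2 / (2 * ((N : ℝ) ^ 2 - 4))) + 1 / 2) * matrixOpNorm B * (((matrixOpNorm B * ((matrixOpNorm B ^ 2 * (1 + matrixOpNorm B / 2 + Real.sqrt (matrixOpNorm B ^ 2 / 4 + 1 / (N : ℝ) ^ 2)) / (2 - 4 / (N : ℝ) ^ 2)) / 2 + Real.sqrt ((matrixOpNorm B ^ 2 * (1 + matrixOpNorm B / 2 + Real.sqrt (matrixOpNorm B ^ 2 / 4 + 1 / (N : ℝ) ^ 2)) / (2 - 4 / (N : ℝ) ^ 2)) ^ 2 / 4 + (matrixOpNorm B ^ 2 * (4 / (N : ℝ) ^ 2 + 2 * (matrixOpNorm B / 2 + Real.sqrt (matrixOpNorm B ^ 2 / 4 + 1 / (N : ℝ) ^ 2)) ^ 2) / (2 - 4 / (N : ℝ) ^ 2))))) + matrixOpNorm B ^ 2) / 4 + Real.sqrt (((matrixOpNorm B * ((matrixOpNorm B ^ 2 * (1 + matrixOpNorm B / 2 + Real.sqrt (matrixOpNorm B ^ 2 / 4 + 1 / (N : ℝ) ^ 2)) / (2 - 4 / (N : ℝ) ^ 2)) / 2 +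 Real.sqrt ((matrixOpNorm B ^ 2 * (1 + matrixOpNorm B / 2 + Real.sqrt (matrixOpNorm B ^ 2 / 4 + 1 / (N : ℝ) ^ 2)) / (2 - 4 / (N : ℝ) ^ 2)) ^ 2 / 4 + (matrixOpNorm B ^ 2 * (4 / (N : ℝ) ^ 2 + 2 * (matrixOpNorm B / 2 + Real.sqrt (matrixOpNorm B ^ 2 / 4 + 1 / (N : ℝ) ^ 2)) ^ 2) / (2 - 4 / (N : ℝ) ^ 2))))) + matrixOpNorm B ^ 2) ^ 2 / 16 + matrixOpNorm B ^ 2 / (N : ℝ) ^ 2))) / (1 / 2 - matrixOpNorm B)) ≤ K)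
    (Δ : Matrix (Fin N) (Fin N) ℂ) (φ : SUN N → ℝ) {L : ℝ} (hφm : Measurable φ) (hφb : ∃ C, ∀ s, |φ s| ≤ C)
    (hL : 0 ≤ L) (hφL : ∀ a b, |φ a - φ b| ≤ L * suFrobDist a b) :
    |∫ s, φ s * ((N : ℝ) * ((s : Matrix (Fin N) (Fin N) ℂ) * Δ).trace.re)
          ∂(haarProbability (SUN N)).tilted (fun g => (N : ℝ) * ((g : Matrix (Fin N) (Fin N) ℂ) * B).trace.re) -
        (∫ s, φ s ∂(haarProbability (SUN N)).tilted (fun g => (N : ℝ) * ((g : Matrix (Fin N) (Fin N) ℂ) * B).trace.re)) *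
          ∫ s, (N : ℝ) * ((s : Matrix (Fin N) (Fin N) ℂ) * Δ).trace.re
            ∂(haarProbability (SUN N)).tilted (fun g => (N : ℝ) * ((g : Matrix (Fin N) (Fin N) ℂ) * B).trace.re)| ≤
      C' * (A + E' * R' + 2 * (E' + 1 / 4) * w
          + (3 / 2 * E' * R' ^ 2 + (2 * E' + 1 / 4) * τ + (10 * E' + 1 / 2) * R' * w) / (1 / 2 - R')
          + 3 / 2 * E' * R' ^ 2 * K) * L * frobNorm Δ := by
  have hB : matrixOpNorm B < 1 / 2 := lt_of_le_of_lt hr hR'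
  have hN0 : N ≠ 0 := by omega
  have hN2 : 2 ≤ N := by omega
  have h3 : (3 : ℝ) ≤ N := by exact_mod_cast hN
  have hNpos : (0 : ℝ) < N := by linarith
  have hNne : (N : ℝ) ≠ 0 := hNpos.ne'
  have hr0 := matrixOpNorm_nonneg B
  have hB0 := frobNorm_nonneg B
  have hD0 := frobNorm_nonneg Δ
  have hW0 : 0 ≤ (N : ℝ) * (((matrixOpNorm B * ((matrixOpNorm B ^ 2 * (1 + matrixOpNorm B / 2 + Real.sqrt (matrixOpNorm B ^ 2 / 4 + 1 / (N : ℝ) ^ 2)) / (2 - 4 / (N : ℝ) ^ 2)) / 2 + Real.sqrt ((matrixOpNorm B ^ 2 * (1 + matrixOpNorm B / 2 + Real.sqrt (matrixOpNorm B ^ 2 / 4 + 1 / (N : ℝ) ^ 2)) / (2 - 4 / (N : ℝ) ^ 2)) ^ 2 / 4 + (matrixOpNorm B ^ 2 * (4 / (N : ℝ) ^ 2 + 2 * (matrixOpNorm B / 2 + Real.sqrt (matrixOpNorm B ^ 2 / 4 + 1 / (N : ℝ) ^ 2)) ^ 2) / (2 - 4 / (N : ℝ) ^ 2))))) + matrixOpNorm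 B ^ 2) / 4 + Real.sqrt (((matrixOpNorm B * ((matrixOpNorm B ^ 2 * (1 + matrixOpNorm B / 2 + Real.sqrt (matrixOpNorm B ^ 2 / 4 + 1 / (N : ℝ) ^ 2)) / (2 - 4 / (N : ℝ) ^ 2)) / 2 + Real.sqrt ((matrixOpNorm B ^ 2 * (1 + matrixOpNorm B / 2 + Real.sqrt (matrixOpNorm B ^ 2 / 4 + 1 / (N : ℝ) ^ 2)) / (2 - 4 / (N : ℝ) ^ 2)) ^ 2 / 4 + (matrixOpNorm B ^ 2 * (4 / (N : ℝ) ^ 2 + 2 * (matrixOpNorm B / 2 + Real.sqrt (matrixOpNorm B ^ 2 / 4 + 1 / (N : ℝ) ^ 2)) ^ 2) / (2 - 4 / (N : ℝ) ^ 2))))) + matrixOpNorm B ^ 2) ^ 2 / 16 + matrixOpNorm B ^ 2 / (N : ℝ) ^ 2)) :=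
    mul_nonneg hNpos.le (omegaTilde_nonneg hN hr0)
  have hZ1 := sqrt_integral_normSq_trace_le_sd_omegaTilde hN B
  have hZ2 := frobNorm_mul_sqrt_integral_normSq_trace_le_sd_omegaTilde hN B Δ
  -- the engine with the split remainder
  have hcov := cov_linear_le_of_poisson_split hN2 hB Δ (contDiff_psiTwo N B Δ) (contDiff_c3prime N B Δ)
    ((N : ℂ) • ((-((((N : ℝ) ^ 2 / (4 * ((N : ℝ) ^ 2 - 4))) / 2 : ℝ) : ℂ)) • (B * Bᴴ * Δ + Δ * Bᴴ * B)
          + ((1 / 2 : ℝ) : ℂ) • (((((N : ℝ) / (2 * ((N : ℝ) ^ 2 - 4)) : ℝ) : ℂ) * (B * Bᴴ).trace - ((1 / (4 * (N : ℝ)) : ℝ) : ℂ) * (starRingEnd ℂ) (B * Bᴴ).trace) • Δ + ((((N : ℝ) / (2 * ((N : ℝ) ^ 2 - 4)) : ℝ) : ℂ) * (Δ * Bᴴ).trace - ((1 / (4 * (N : ℝ)) : ℝ) : ℂ) * (starRingEnd ℂ) (Δ * Bᴴ).trace) • B))) (fun g => c3_split hN B Δ g) φ hφm hφb hL hφL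
  -- the nested linear term through the level-two modulus bound with `Δ := M_ℓ`
  set Mℓ : Matrix (Fin N) (Fin N) ℂ := ((-((((N : ℝ) ^ 2 / (4 * ((N : ℝ) ^ 2 - 4))) / 2 : ℝ) : ℂ)) • (B * Bᴴ * Δ + Δ * Bᴴ * B)
          + ((1 / 2 : ℝ) : ℂ) • (((((N : ℝ) / (2 * ((N : ℝ) ^ 2 - 4)) : ℝ) : ℂ) * (B * Bᴴ).trace - ((1 / (4 * (N : ℝ)) : ℝ) : ℂ) * (starRingEnd ℂ) (B * Bᴴ).trace) • Δ + ((((N : ℝ) / (2 * ((N : ℝ) ^ 2 - 4)) : ℝ) : ℂ) * (Δ * Bᴴ).trace - ((1 / (4 * (N : ℝ)) : ℝ) : ℂ) * (starRingEnd ℂ) (Δ * Bᴴ).trace) • B)) with hMℓ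
  have hlin := cov_linear_le_levelTwoQT_explicit hN hB Mℓ φ hφm hφb hL hφL
  have epot : (fun s : SUN N => φ s * pot 1 ((N : ℂ) • Mℓ) (s : Matrix (Fin N) (Fin N) ℂ)) =
      fun s : SUN N => φ s * ((N : ℝ) * ((s : Matrix (Fin N) (Fin N) ℂ) * Mℓ).trace.re) := by
    funext s; rw [pot_one_natSmul]
  have epot' : (fun s : SUN N => pot 1 ((N : ℂ) • Mℓ) (s : Matrix (Fin N) (Fin N) ℂ)) =
      fun s : SUN N => (N : ℝ) * ((s : Matrix (Fin N) (Fin N) ℂ) * Mℓ).trace.re := by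
    funext s; rw [pot_one_natSmul]
  rw [epot, epot'] at hcov
  -- the Frobenius norm of `M_ℓ` from that of `N • M_ℓ`
  have hbig := frobNorm_linPart_le hN B Δ
  have hnM : frobNorm Mℓ ≤ frobNorm Δ * (((N : ℝ) ^ 2 / (4 * ((N : ℝ) ^ 2 - 4))) * matrixOpNorm B ^ 2
      + ((N : ℝ) / (2 * ((N : ℝ) ^ 2 - 4))) * frobNorm B ^ 2) := by
    rw [← hMℓ, frobNorm_smul, Complex.norm_natCast] at hbig
    exact le_of_mul_le_mul_left hbig hNpos
  have hKQ := levelTwoQT_nonneg hN hr0 hB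
  have h1 := levelTwo_algebraWAQB hN rfl rfl rfl rfl rfl rfl hr0 hB hB0 hD0 hL (frobNorm_le_sqrt_mul_matrixOpNorm B) hW0 hZ1 hZ2
    (sqrt_integral_normSq_quadBB_le_scale hN B) (frobNorm_mul_sqrt_integral_normSq_quadDB_le hN B Δ) hKQ hnM hlin
    (sqrt_integral_Gam_upsi_le_omegaPlus hN B Δ) (sqrt_integral_Gam_c3prime_le_quad hN B Δ) hcov
  rw [levelTwo_idW1 hNne, levelTwo_idW2 hNne] at h1
  refine h1.trans (mul_le_mul_of_nonneg_right (mul_le_mul_of_nonneg_right ?_ hL) hD0)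
  have hC0 : 0 ≤ (N : ℝ) ^ 2 / ((N : ℝ) ^ 2 - 1) := div_nonneg (by positivity) (by nlinarith only [h3])
  have hE0 : 0 ≤ (N : ℝ) ^ 2 / (2 * ((N : ℝ) ^ 2 - 4)) := div_nonneg (by positivity) (by nlinarith only [h3])
  exact levelTwoBShape_mono hC hA hE hr hw hτ hK hC0 (Real.sqrt_nonneg _) hE0 hr0 (omegaTilde_nonneg hN hr0)
    (tau_nonneg hN hr0) hKQ hR'

/-! ### The modulus -/

set_option maxHeartbeats 400000 in
/-- **THE `ω̃` LINEAR-BOOTSTRAP LEVEL-TWO ONE-LINK KANTOROVICH–RUBINSTEIN MODULUS, EVERY `SU(N)`, `N ≥ 3`, HYPOTHESIS-FREE, with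
abstract majorants at the radius**: for `R ≤ R' < 1/2` and majorants `A, w, τ, K, C', E'` of the ingredients AT RADIUS `R`,
`OneLinkKRModulus N R (C'(A + E'R' + 2(E'+¼)w + ((3/2)E'R'² + (2E'+¼)τ + (10E'+½)R'w)/(½−R') + (3/2)E'R'²K))`.  Proof:
`cov_linear_le_levelTwoBT_of_le` along the segment `B_t = B + t(B' − B)` (convexity of the ball; the ingredients at `‖B_t‖_op ≤ R`
are below those at `R` by `omegaPlus_mono`, `omegaTilde_mono`, `tau_mono` and the nested `levelTwoQShape_mono`) and the
tilt-interpolation lemma `abs_integral_tilted_add_sub_le_of_cov`; double heartbeats for the elaboration of the ingredient binders. [cite: arXiv220412737, Lemma 4.1 and Rem. 1.3] -/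
theorem oneLinkKRModulus_levelTwoBT_of_le (hN : 3 ≤ N) {R R' C' E' A w τ K : ℝ} (hRR' : R ≤ R') (hR' : R' < 1 / 2)
    (hC : (N : ℝ) ^ 2 / ((N : ℝ) ^ 2 - 1) ≤ C') (hE : (N : ℝ) ^ 2 / (2 * ((N : ℝ) ^ 2 - 4)) ≤ E')
    (hA : Real.sqrt ((1 +
            (2 * ((N : ℝ) * (2 * (N : ℝ) - 4 / N) / ((2 * (N : ℝ) - 4 / N) ^ 2 - 4)) *
            (R + (R ^ 2 / 2 + R * Real.sqrt (R ^ 2 / 4 + 1 / (N : ℝ) ^ 2)))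
          + 2 * (2 * (N : ℝ) / ((2 * (N : ℝ) - 4 / N) ^ 2 - 4)) * N *
            ((R ^ 2 / 2 + R * Real.sqrt (R ^ 2 / 4 + 1 / (N : ℝ) ^ 2))
              + R * (R / 2 + Real.sqrt (R ^ 2 / 4 + 1 / (N : ℝ) ^ 2)) ^ 2))) / 2) ≤ A)
    (hw : (((R * ((R ^ 2 * (1 + R / 2 + Real.sqrt (R ^ 2 / 4 + 1 / (N : ℝ) ^ 2)) / (2 - 4 / (N : ℝ) ^ 2)) / 2 + Real.sqrt ((R ^ 2 * (1 + R / 2 + Real.sqrt (R ^ 2 / 4 + 1 / (N : ℝ) ^ 2)) / (2 - 4 / (N : ℝ) ^ 2)) ^ 2 / 4 + (R ^ 2 * (4 / (N : ℝ) ^ 2 + 2 * (R / 2 + Real.sqrt (R ^ 2 / 4 + 1 / (N : ℝ) ^ 2)) ^ 2) / (2 - 4 / (N : ℝ) ^ 2))))) + R ^ 2) / 4 + Real.sqrt (((R * ((R ^ 2 * (1 + R / 2 + Real.sqrt (R ^ 2 / 4 + 1 / (N : ℝ) ^ 2)) / (2 - 4 / (N : ℝ) ^ 2)) / 2 + Real.sqrt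 ((R ^ 2 * (1 + R / 2 + Real.sqrt (R ^ 2 / 4 + 1 / (N : ℝ) ^ 2)) / (2 - 4 / (N : ℝ) ^ 2)) ^ 2 / 4 + (R ^ 2 * (4 / (N : ℝ) ^ 2 + 2 * (R / 2 + Real.sqrt (R ^ 2 / 4 + 1 / (N : ℝ) ^ 2)) ^ 2) / (2 - 4 / (N : ℝ) ^ 2))))) + R ^ 2) ^ 2 / 16 + R ^ 2 / (N : ℝ) ^ 2)) ≤ w)
    (hτ : (R * ((R ^ 2 * (1 + R / 2 + Real.sqrt (R ^ 2 / 4 + 1 / (N : ℝ) ^ 2)) / (2 - 4 / (N : ℝ) ^ 2)) / 2 + Real.sqrt ((R ^ 2 * (1 + R / 2 + Real.sqrt (R ^ 2 / 4 + 1 / (N : ℝ) ^ 2)) / (2 - 4 / (N : ℝ) ^ 2)) ^ 2 / 4 + (R ^ 2 * (4 / (N : ℝ) ^ 2 + 2 * (R / 2 + Real.sqrt (R ^ 2 / 4 + 1 / (N : ℝ) ^ 2)) ^ 2) / (2 - 4 / (N : ℝ) ^ 2))))) ≤ τ)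
    (hK : ((N : ℝ) ^ 2 / ((N : ℝ) ^ 2 - 1)) *
        (Real.sqrt ((1 +
            (2 * ((N : ℝ) * (2 * (N : ℝ) - 4 / N) / ((2 * (N : ℝ) - 4 / N) ^ 2 - 4)) *
            (R + (R ^ 2 / 2 + R * Real.sqrt (R ^ 2 / 4 + 1 / (N : ℝ) ^ 2)))
          + 2 * (2 * (N : ℝ) / ((2 * (N : ℝ) - 4 / N) ^ 2 - 4)) * N *
            ((R ^ 2 / 2 + R * Real.sqrt (R ^ 2 / 4 + 1 / (N : ℝ) ^ 2))
              + R * (R / 2 + Real.sqrt (R ^ 2 / 4 + 1 / (N : ℝ) ^ 2)) ^ 2))) / 2)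
          + ((N : ℝ) ^ 2 / (2 * ((N : ℝ) ^ 2 - 4))) * R + 2 * (((N : ℝ) ^ 2 / (2 * ((N : ℝ) ^ 2 - 4))) + 1 / 4) * (((R * ((R ^ 2 * (1 + R / 2 + Real.sqrt (R ^ 2 / 4 + 1 / (N : ℝ) ^ 2)) / (2 - 4 / (N : ℝ) ^ 2)) / 2 + Real.sqrt ((R ^ 2 * (1 + R / 2 + Real.sqrt (R ^ 2 / 4 + 1 / (N : ℝ) ^ 2)) / (2 - 4 / (N : ℝ) ^ 2)) ^ 2 / 4 + (R ^ 2 * (4 / (N : ℝ) ^ 2 + 2 * (R / 2 + Real.sqrt (R ^ 2 / 4 + 1 / (N : ℝ) ^ 2)) ^ 2) / (2 - 4 / (N : ℝ) ^ 2))))) + R ^ 2) / 4 + Real.sqrt (((R * ((R ^ 2 * (1 + R / 2 + Real.sqrt (R ^ 2 / 4 + 1 / (N : ℝ) ^ 2)) / (2 - 4 / (N : ℝ) ^ 2)) / 2 + Real.sqrt ((R ^ 2 * (1 + R / 2 + Real.sqrt (R ^ 2 / 4 + 1 / (N : ℝ) ^ 2)) / (2 - 4 / (N : ℝ) ^ 2))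 ^ 2 / 4 + (R ^ 2 * (4 / (N : ℝ) ^ 2 + 2 * (R / 2 + Real.sqrt (R ^ 2 / 4 + 1 / (N : ℝ) ^ 2)) ^ 2) / (2 - 4 / (N : ℝ) ^ 2))))) + R ^ 2) ^ 2 / 16 + R ^ 2 / (N : ℝ) ^ 2))
          + (3 * ((N : ℝ) ^ 2 / (2 * ((N : ℝ) ^ 2 - 4))) * R ^ 2 + (2 * ((N : ℝ) ^ 2 / (2 * ((N : ℝ) ^ 2 - 4))) + 1 / 4) * (R * ((R ^ 2 * (1 + R / 2 + Real.sqrt (R ^ 2 / 4 + 1 / (N : ℝ) ^ 2)) / (2 - 4 / (N : ℝ) ^ 2)) / 2 + Real.sqrt ((R ^ 2 * (1 + R / 2 + Real.sqrt (R ^ 2 / 4 + 1 / (N : ℝ) ^ 2)) / (2 - 4 / (N : ℝ) ^ 2)) ^ 2 / 4 + (R ^ 2 * (4 / (N : ℝ) ^ 2 + 2 * (R / 2 + Real.sqrt (R ^ 2 / 4 + 1 / (N : ℝ) ^ 2)) ^ 2) / (2 - 4 / (N : ℝ) ^ 2)))))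
              + (10 * ((N : ℝ) ^ 2 / (2 * ((N : ℝ) ^ 2 - 4))) + 1 / 2) * R * (((R * ((R ^ 2 * (1 + R / 2 + Real.sqrt (R ^ 2 / 4 + 1 / (N : ℝ) ^ 2)) / (2 - 4 / (N : ℝ) ^ 2)) / 2 + Real.sqrt ((R ^ 2 * (1 + R / 2 + Real.sqrt (R ^ 2 / 4 + 1 / (N : ℝ) ^ 2)) / (2 - 4 / (N : ℝ) ^ 2)) ^ 2 / 4 + (R ^ 2 * (4 / (N : ℝ) ^ 2 + 2 * (R / 2 + Real.sqrt (R ^ 2 / 4 + 1 / (N : ℝ) ^ 2)) ^ 2) / (2 - 4 / (N : ℝ) ^ 2))))) + R ^ 2) / 4 + Real.sqrt (((R * ((R ^ 2 * (1 + R / 2 + Real.sqrt (R ^ 2 / 4 + 1 / (N : ℝ) ^ 2)) / (2 - 4 / (N : ℝ) ^ 2)) / 2 + Real.sqrt ((R ^ 2 * (1 + R / 2 + Real.sqrt (R ^ 2 / 4 + 1 / (N : ℝ) ^ 2)) / (2 - 4 / (N : ℝ) ^ 2)) ^ 2 / 4 + (R ^ 2 * (4 / (N : ℝ) ^ 2 +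 2 * (R / 2 + Real.sqrt (R ^ 2 / 4 + 1 / (N : ℝ) ^ 2)) ^ 2) / (2 - 4 / (N : ℝ) ^ 2))))) + R ^ 2) ^ 2 / 16 + R ^ 2 / (N : ℝ) ^ 2))) / (1 / 2 - R)) ≤ K) :
    OneLinkKRModulus N R
      (C' * (A + E' * R' + 2 * (E' + 1 / 4) * w
          + (3 / 2 * E' * R' ^ 2 + (2 * E' + 1 / 4) * τ + (10 * E' + 1 / 2) * R' * w) / (1 / 2 - R')
          + 3 / 2 * E' * R' ^ 2 * K)) := by
  classical
  intro B B' hB hB' φ L hφm hφb hL hφL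
  have hN0 : N ≠ 0 := by omega
  have hNpos : (0 : ℝ) < N := Nat.cast_pos.2 (Nat.pos_of_ne_zero hN0)
  have hR2 : R < 1 / 2 := lt_of_le_of_lt hRR' hR'
  set f : SUN N → ℝ := fun g => (N : ℝ) * ((g : Matrix (Fin N) (Fin N) ℂ) * B).trace.re with hf
  set w' : SUN N → ℝ := fun g => (N : ℝ) * ((g : Matrix (Fin N) (Fin N) ℂ) * (B' - B)).trace.re with hw'
  have hfw : (fun g : SUN N => (N : ℝ) * ((g : Matrix (Fin N) (Fin N) ℂ) * B').trace.re) = fun g => f g + w' g := by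
    funext g
    simp only [hf, hw', Matrix.mul_sub, trace_sub, Complex.sub_re]
    ring
  rw [hfw, abs_sub_comm]
  have hfm : Measurable f := (continuous_const.mul (continuous_re_trace_su_mul B)).measurable
  have hwm : Measurable w' := (continuous_const.mul (continuous_re_trace_su_mul (B' - B))).measurable
  have hfb : ∃ C, ∀ s, |f s| ≤ C := ⟨(N : ℝ) * (Real.sqrt N * frobNorm B), fun s => by
    simp only [hf]
    rw [abs_mul, abs_of_nonneg hNpos.le]
    exact mul_le_mul_of_nonneg_left (abs_re_trace_su_mul_le s B) hNpos.le⟩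
  have hwb : ∀ s, |w' s| ≤ (N : ℝ) * (Real.sqrt N * frobNorm (B' - B)) := fun s => by
    simp only [hw']
    rw [abs_mul, abs_of_nonneg hNpos.le]
    exact mul_le_mul_of_nonneg_left (abs_re_trace_su_mul_le s _) hNpos.le
  have key := abs_integral_tilted_add_sub_le_of_cov (μ := haarProbability (SUN N))
    (A := C' * (A + E' * R' + 2 * (E' + 1 / 4) * w
          + (3 / 2 * E' * R' ^ 2 + (2 * E' + 1 / 4) * τ + (10 * E' + 1 / 2) * R' * w) / (1 / 2 - R')
          + 3 / 2 * E' * R' ^ 2 * K) * L * frobNorm (B' - B))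
    hfm hfb hwm hwb hφm hφb ?_
  · rw [frobNorm_sub_comm] at key
    exact key
  · intro t ht
    set Bt : Matrix (Fin N) (Fin N) ℂ := B + (t : ℂ) • (B' - B) with hBt
    have hft : (fun u : SUN N => f u + t * w' u) =
        fun g : SUN N => (N : ℝ) * ((g : Matrix (Fin N) (Fin N) ℂ) * Bt).trace.re := by
      funext g
      simp only [hf, hw', hBt, Matrix.mul_add, Matrix.mul_smul, trace_add, trace_smul, Complex.add_re, smul_eq_mul,
        Complex.re_ofReal_mul]
      ring
    have hBt_le : matrixOpNorm Bt ≤ R := by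
      have h1 : Bt = ((1 - t : ℝ) : ℂ) • B + ((t : ℝ) : ℂ) • B' := by
        rw [hBt]; push_cast; simp only [smul_sub, sub_smul, one_smul]; abel
      rw [h1]
      calc matrixOpNorm (((1 - t : ℝ) : ℂ) • B + ((t : ℝ) : ℂ) • B')
          ≤ matrixOpNorm (((1 - t : ℝ) : ℂ) • B) + matrixOpNorm (((t : ℝ) : ℂ) • B') := matrixOpNorm_add_le _ _
        _ = (1 - t) * matrixOpNorm B + t * matrixOpNorm B' := by
            rw [matrixOpNorm_smul, matrixOpNorm_smul, Complex.norm_real, Complex.norm_real, Real.norm_eq_abs,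
              Real.norm_eq_abs, abs_of_nonneg (by linarith [ht.2]), abs_of_nonneg ht.1]
        _ ≤ (1 - t) * R + t * R :=
            add_le_add (mul_le_mul_of_nonneg_left hB (by linarith [ht.2])) (mul_le_mul_of_nonneg_left hB' ht.1)
        _ = R := by ring
    have h3 : (3 : ℝ) ≤ N := by exact_mod_cast hN
    have hr0 := matrixOpNorm_nonneg Bt
    have hC0 : 0 ≤ (N : ℝ) ^ 2 / ((N : ℝ) ^ 2 - 1) := div_nonneg (by positivity) (by nlinarith only [h3])
    have hE0 : 0 ≤ (N : ℝ) ^ 2 / (2 * ((N : ℝ) ^ 2 - 4)) := div_nonneg (by positivity) (by nlinarith only [h3])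
    have hwm := omegaTilde_mono hN hr0 hBt_le
    have hw0 := omegaTilde_nonneg hN hr0
    have htm := tau_mono hN hr0 hBt_le
    have ht0 := tau_nonneg hN hr0
    have hom := omegaPlus_mono hN hr0 hBt_le
    have hcov := cov_linear_le_levelTwoBT_of_le hN (hBt_le.trans hRR') hR' hC hE
      ((Real.sqrt_le_sqrt (div_le_div_of_nonneg_right (add_le_add (le_refl (1 : ℝ)) hom) (by norm_num))).trans hA)
      (hwm.trans hw) (htm.trans hτ)
      ((levelTwoQShape_mono hC0 hE0
        (Real.sqrt_le_sqrt (div_le_div_of_nonneg_right (add_le_add (le_refl (1 : ℝ)) hom) (by norm_num)))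
        hBt_le hwm htm hr0 hw0 ht0 hR2).trans hK)
      (B' - B) φ hφm hφb hL hφL
    rw [← hft] at hcov
    exact hcov

end Summit.Ventures.YMGap.OneLinkEigen
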